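import Literature.NumberTheory.Transcendental.OddZetaPartialFractions
import Literature.NumberTheory.LFunctions.LcmUptoCubeBound
import HarnessLib

/-!
# Odd zeta values II: the Ball–Rivoal series with Sprang's twists

The rational function behind the linear forms in odd zeta values (Ball–Rivoal 2001, with the
normalisation of Fischler–Sprang–Zudilin 2019, §2, and the additional Ball–Rivoal parameter
`r` of their Remark 1):

`R_n(t) = D^L · n!^{s+1-(2r+1)D} · ∏_{l=0}^{L} (t - rn + l/D) / ∏_{k=0}^{n} (t+k)^{s+1}`,
`L = (2r+1)Dn` (`Rfun r D s n t`).

Contents: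

* `isExp_Rfun`: `R_n` is a product of `s+1` simple factors with integer residues
  (`G̃ · G^{s-(2r+1)D} · ∏_b F_{α_b}`, FSZ 2019 eq. (3.3)), hence an integral expansion of
  level `s+1` (`OddZetaPartialFractions`): `R_n(t) = ∑_{k,i} a_{i,k} (t+k)^{-i}` with
  `d_n^{s+1-i} a_{i,k} ∈ ℤ` (FSZ Lemma 2, first half; Ball–Rivoal Lemme 5).
* `Rfun_neg`: the well-poised symmetry `R_n(-n-t) = -R_n(t)` (`L` even, `s` odd)
  (Ball–Rivoal Lemme 1; FSZ end of proof of Lemma 1).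
* `abs_Rfun_le`: `|R_n(t)| ≤ K t^{-2}` for large `t`; summability of `m ↦ R_n(m + α)`.
* `linearForms`: for `α = j/D`, `0 < j ≤ D`,
  `∑_{m ≥ 1} R_n(m + j/D) = ρ_{0,j} + ∑_{3 ≤ i ≤ s, i odd} ρ_i ζ(i, j/D)` with
  `ζ(i, α) = ∑_{ν ≥ 0} (ν+α)^{-i}` (`hz`), `ρ_i` independent of `j`, `ρ_i = 0` for even `i`,
  `2 d_n^{s+1-i} ρ_i ∈ ℤ` and `2 d_{D(n+1)}^{s+1} ρ_{0,j} ∈ ℤ` (FSZ Lemma 1 and Lemma 2 — with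
  the cruder denominator `d_{D(n+1)}` in place of FSZ's `d_{n+1}`, which is all we need, and
  the symmetry used through *averaging* the expansion with its mirror image, so that no
  uniqueness of partial fractions is required; the factor `2` is the price).

## References
* [BallRivoal2001] K. Ball, T. Rivoal, Invent. Math. 146 (2001), Lemmes 1, 5.
* [FischlerSprangZudilin2019] S. Fischler, J. Sprang, W. Zudilin, Compositio Math. 155 (2019),
  §2 Lemma 1, §3 Lemma 2, Remark 1 (arXiv:1803.08905).
* [Sprang2018OddZeta] J. Sprang, arXiv:1802.09410, Lemma 1.5.
* [Zudilin2018OddZeta] W. Zudilin, SIGMA 14 (2018) 028, Lemmas 2–3.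
-/

noncomputable section

open Finset Filter Topology

open scoped Nat

namespace Literature.NumberTheory.Transcendental.OddZeta

/-! ### The rational function -/

/-- `L = (2r+1)·D·n`, the number of numerator factors minus one. [cite: FischlerSprangZudilin2019, §2 (definition of R_n) and Remark 1] -/
def Lnum (r D n : ℕ) : ℕ := (2 * r + 1) * D * n

/-- The Ball–Rivoal / Fischler–Sprang–Zudilin rational function
`R_n(t) = D^L n!^{s+1-(2r+1)D} ∏_{l=0}^{L}(t - rn + l/D) / ∏_{k=0}^{n}(t+k)^{s+1}`.
[cite: FischlerSprangZudilin2019, §2 (definition of R_n) and Remark 1] -/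
def Rfun (r D s n : ℕ) (t : ℝ) : ℝ :=
  (D : ℝ) ^ Lnum r D n * (n ! : ℝ) ^ (s + 1 - (2 * r + 1) * D) *
    (∏ l ∈ range (Lnum r D n + 1), (t - r * n + (l : ℝ) / D)) /
    ∏ k ∈ range (n + 1), (t + k) ^ (s + 1)

/-- Nested products over blocks: `∏_{b<B} ∏_{j<n} f(bn+j) = ∏_{l<Bn} f(l)`. [folklore] -/
theorem prod_range_mul_nest (f : ℕ → ℝ) (B n : ℕ) :
    ∏ b ∈ range B, ∏ j ∈ range n, f (b * n + j) = ∏ l ∈ range (B * n), f l := by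
  induction B with
  | zero => simp
  | succ B ih =>
    rw [prod_range_succ, ih, Nat.succ_mul, prod_range_add]

/-- **`R_n` is an integral expansion of level `s+1`** (Ball–Rivoal 2001, Lemme 5;
Fischler–Sprang–Zudilin 2019, Lemma 2 (3.1) via the product formula (3.3)
`R_n = G̃ · G^{s-(2r+1)D} · ∏_{b<(2r+1)D} F_{-rn+bn/D}`): off the poles,
`R_n(t) = ∑_{k ≤ n} ∑_{1 ≤ i ≤ s+1} a_{i,k}/(t+k)^i` with `d_n^{s+1-i} a_{i,k} ∈ ℤ`.
[cite: FischlerSprangZudilin2019, Lemma 2 (3.1)] -/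
theorem isExp_Rfun {r D s n : ℕ} (hn : 1 ≤ n) (hD : 0 < D) (hs : (2 * r + 1) * D ≤ s) :
    IsExp n (s + 1) (Rfun r D s n) := by
  set a := s - (2 * r + 1) * D with ha
  set B := (2 * r + 1) * D with hB
  -- the three kinds of factors
  set Gt : ℝ → ℝ := fun t => (n ! : ℝ) * (t - (r * n : ℕ)) / ∏ k ∈ range (n + 1), (t + k)
    with hGt
  set G : ℝ → ℝ := fun t => (n ! : ℝ) / ∏ k ∈ range (n + 1), (t + k) with hG
  set F : ℕ → ℝ → ℝ := fun b t => (D : ℝ) ^ n *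
      (∏ j ∈ range n, (t + (((b * n : ℕ) : ℤ) - ((D * r * n : ℕ) : ℤ) : ℤ) / D + ((j : ℝ) + 1) / D)) /
      ∏ k ∈ range (n + 1), (t + k) with hF
  have h1 : IsExp n 1 Gt := (isSimple_Gtilde n (r * n) hn).isExp
  have h2 : IsExp n (1 + (range a).card) (fun t => Gt t * ∏ _i ∈ range a, G t) :=
    h1.mul_prod_isSimple (range a) fun _ _ => isSimple_G n
  have h3 : IsExp n (1 + (range a).card + (range B).card)
      (fun t => (Gt t * ∏ _i ∈ range a, G t) * ∏ b ∈ range B, F b t) :=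
    h2.mul_prod_isSimple (range B) fun b _ => isSimple_F n D hD _
  rw [card_range, card_range] at h3
  have hlev : 1 + a + B = s + 1 := by omega
  rw [hlev] at h3
  refine h3.congr fun t ht => ?_
  -- the algebraic identity `R_n = G̃ · G^a · ∏ F_b`
  have hP : ∏ k ∈ range (n + 1), (t + k) ≠ 0 :=
    prod_ne_zero_iff.2 fun k hk => ht k (by simpa [Nat.lt_succ_iff] using hk)
  set P := ∏ k ∈ range (n + 1), (t + k) with hPdef
  have hD' : (D : ℝ) ≠ 0 := by exact_mod_cast hD.ne'
  -- numerator of the product of the `F_b`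
  have hnum : ∏ b ∈ range B, ∏ j ∈ range n,
      (t + (((b * n : ℕ) : ℤ) - ((D * r * n : ℕ) : ℤ) : ℤ) / D + ((j : ℝ) + 1) / D) =
      ∏ l ∈ range (Lnum r D n), (t - r * n + ((l : ℝ) + 1) / D) := by
    rw [Lnum, show (2 * r + 1) * D * n = B * n by rw [hB]]
    rw [← prod_range_mul_nest (fun l => t - r * n + ((l : ℝ) + 1) / D) B n]
    refine prod_congr rfl fun b _ => prod_congr rfl fun j _ => ?_
    push_cast
    field_simp
    ring
  have hGprod : ∏ _i ∈ range a, G t = ((n ! : ℝ) / P) ^ a := by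
    rw [prod_const, card_range]
  have hFprod : ∏ b ∈ range B, F b t =
      (D : ℝ) ^ (n * B) * (∏ l ∈ range (Lnum r D n), (t - r * n + ((l : ℝ) + 1) / D)) / P ^ B := by
    rw [hF]
    simp only
    rw [prod_div_distrib, prod_const, card_range, prod_mul_distrib, prod_const, card_range,
      ← pow_mul, hnum]
  rw [hGprod, hFprod, hGt, Rfun]
  simp only
  rw [← hPdef]
  have hLfac : ∏ l ∈ range (Lnum r D n + 1), (t - r * n + (l : ℝ) / D) =
      (t - r * n) * ∏ l ∈ range (Lnum r D n), (t - r * n + ((l : ℝ) + 1) / D) := by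
    rw [prod_range_succ']
    push_cast
    simp only [zero_div, add_zero]
    ring
  have hden : ∏ k ∈ range (n + 1), (t + k) ^ (s + 1) = P ^ (s + 1) := by
    rw [hPdef, prod_pow]
  rw [hLfac, hden]
  have hpow : (n ! : ℝ) ^ (s + 1 - (2 * r + 1) * D) = (n ! : ℝ) * (n ! : ℝ) ^ a := by
    rw [ha, show s + 1 - (2 * r + 1) * D = (s - (2 * r + 1) * D) + 1 by omega, pow_succ]
    ring
  have hDL : (D : ℝ) ^ Lnum r D n = (D : ℝ) ^ (n * B) := by
    rw [Lnum, hB]; ring_nf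
  rw [hpow, hDL, div_pow]
  have hs1 : s + 1 = 1 + a + B := hlev.symm
  rw [hs1, pow_add, pow_add, pow_one]
  push_cast
  field_simp

/-! ### The well-poised symmetry -/

/-- **Well-poised symmetry** (Ball–Rivoal 2001, Lemme 1; FSZ 2019, end of proof of Lemma 1):
if `L = (2r+1)Dn` is even and `s` is odd then `R_n(-n-t) = -R_n(t)`.
[cite: FischlerSprangZudilin2019, Lemma 1 (proof, symmetry R_n(-n-t) = -R_n(t))] -/
theorem Rfun_neg {r D s n : ℕ} (hD : 0 < D) (hL : Even (Lnum r D n)) (hs : Odd s) (t : ℝ) :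
    Rfun r D s n (-n - t) = -Rfun r D s n t := by
  have hD' : (D : ℝ) ≠ 0 := by exact_mod_cast hD.ne'
  set L := Lnum r D n with hLdef
  -- numerator
  have hnum : ∏ l ∈ range (L + 1), (-(n : ℝ) - t - r * n + (l : ℝ) / D) =
      -∏ l ∈ range (L + 1), (t - r * n + (l : ℝ) / D) := by
    have hLD : ((L : ℕ) : ℝ) / D = (2 * r + 1) * n := by
      rw [hLdef, Lnum]; push_cast; field_simp
    have e1 : ∏ l ∈ range (L + 1), (-(n : ℝ) - t - r * n + (l : ℝ) / D) =
        ∏ l ∈ range (L + 1), ((-1 : ℝ) * (t - r * n + (((L + 1 - 1 - l : ℕ) : ℝ)) / D)) := by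
      refine prod_congr rfl fun l hl => ?_
      have hl' : l ≤ L := by simpa [Nat.lt_succ_iff] using hl
      rw [show L + 1 - 1 - l = L - l by omega, Nat.cast_sub hl', sub_div, hLD]
      ring
    rw [e1, prod_mul_distrib, prod_const, card_range,
      prod_range_reflect (fun l => t - r * n + ((l : ℕ) : ℝ) / D) (L + 1)]
    rw [Odd.neg_one_pow (by rcases hL with ⟨m, hm⟩; exact ⟨m, by omega⟩)]
    ring
  -- denominator
  have hden : ∏ k ∈ range (n + 1), (-(n : ℝ) - t + k) ^ (s + 1) =
      ∏ k ∈ range (n + 1), (t + k) ^ (s + 1) := by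
    have e1 : ∏ k ∈ range (n + 1), (-(n : ℝ) - t + k) ^ (s + 1) =
        ∏ k ∈ range (n + 1), (t + ((n + 1 - 1 - k : ℕ) : ℝ)) ^ (s + 1) := by
      refine prod_congr rfl fun k hk => ?_
      have hk' : k ≤ n := by simpa [Nat.lt_succ_iff] using hk
      rw [show n + 1 - 1 - k = n - k by omega, Nat.cast_sub hk']
      have hs1 : Even (s + 1) := hs.add_one
      rw [show -(n : ℝ) - t + k = -(t + (n - k)) by ring, Even.neg_pow hs1]
    rw [e1, prod_range_reflect (fun k => (t + ((k : ℕ) : ℝ)) ^ (s + 1)) (n + 1)]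
  unfold Rfun
  rw [← hLdef, hnum, hden]
  ring

/-! ### Decay at infinity -/

/-- The constant in the decay bound. [folklore] -/
def Kdec (r D s n : ℕ) : ℝ :=
  (D : ℝ) ^ Lnum r D n * (n ! : ℝ) ^ (s + 1 - (2 * r + 1) * D) * (2 * r + 2) ^ (Lnum r D n + 1)

/-- `0 ≤ Kdec`. [folklore] -/
theorem Kdec_nonneg (r D s n : ℕ) : 0 ≤ Kdec r D s n := by
  unfold Kdec; positivity

/-- **Decay:** for `t ≥ max 1 ((r+1) n)` (so `t > rn` and all numerator factors are in
`(0, (2r+2)t]`) and `(2r+1)D + 2 ≤ s + 1`, `0 ≤ R_n(t) ≤ K / t²`. [folklore] -/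
theorem Rfun_bounds {r D s n : ℕ} (hn : 1 ≤ n) (hD : 0 < D) (hs : (2 * r + 1) * D + 2 ≤ s + 1)
    {t : ℝ} (ht1 : 1 ≤ t) (ht : ((r : ℝ) + 1) * n ≤ t) :
    0 ≤ Rfun r D s n t ∧ Rfun r D s n t ≤ Kdec r D s n / t ^ 2 := by
  have hD' : (0 : ℝ) < D := by exact_mod_cast hD
  have hn' : (1 : ℝ) ≤ n := by exact_mod_cast hn
  have htpos : 0 < t := by linarith
  have hrn : (r : ℝ) * n < t := by nlinarith
  set L := Lnum r D n with hLdef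
  -- numerator factors
  have hfac : ∀ l ∈ range (L + 1), 0 < t - r * n + (l : ℝ) / D ∧
      t - r * n + (l : ℝ) / D ≤ (2 * r + 2) * t := by
    intro l hl
    have hl' : (l : ℝ) ≤ L := by exact_mod_cast (by simpa [Nat.lt_succ_iff] using hl)
    have hLD : ((L : ℕ) : ℝ) / D = (2 * r + 1) * n := by
      rw [hLdef, Lnum]; push_cast; field_simp
    refine ⟨by positivity, ?_⟩
    have h1 : (l : ℝ) / D ≤ (2 * r + 1) * n := by
      rw [← hLD]; exact div_le_div_of_nonneg_right hl' hD'.le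
    have h2 : (n : ℝ) ≤ t := by nlinarith
    nlinarith
  have hnum_pos : 0 < ∏ l ∈ range (L + 1), (t - r * n + (l : ℝ) / D) :=
    prod_pos fun l hl => (hfac l hl).1
  have hnum_le : ∏ l ∈ range (L + 1), (t - r * n + (l : ℝ) / D) ≤ ((2 * r + 2) * t) ^ (L + 1) := by
    calc ∏ l ∈ range (L + 1), (t - r * n + (l : ℝ) / D) ≤ ∏ _l ∈ range (L + 1), ((2 * r + 2) * t) :=
          prod_le_prod (fun l hl => (hfac l hl).1.le) fun l hl => (hfac l hl).2
      _ = ((2 * r + 2) * t) ^ (L + 1) := by rw [prod_const, card_range]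
  -- denominator
  have hden_pos : 0 < ∏ k ∈ range (n + 1), (t + k) ^ (s + 1) :=
    prod_pos fun k _ => by positivity
  have hden_ge : t ^ ((n + 1) * (s + 1)) ≤ ∏ k ∈ range (n + 1), (t + k) ^ (s + 1) := by
    calc t ^ ((n + 1) * (s + 1)) = ∏ _k ∈ range (n + 1), t ^ (s + 1) := by
          rw [prod_const, card_range, ← pow_mul, mul_comm]
      _ ≤ ∏ k ∈ range (n + 1), (t + k) ^ (s + 1) := by
          refine prod_le_prod (fun k _ => by positivity) fun k _ => ?_
          exact pow_le_pow_left₀ htpos.le (by linarith [(Nat.cast_nonneg (α := ℝ) k)]) _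
  have hC : 0 ≤ (D : ℝ) ^ L * (n ! : ℝ) ^ (s + 1 - (2 * r + 1) * D) := by positivity
  constructor
  · unfold Rfun; rw [← hLdef]; positivity
  · unfold Rfun Kdec
    rw [← hLdef, div_le_div_iff₀ hden_pos (by positivity)]
    -- compare degrees: `(L+1) + 2 ≤ (n+1)(s+1)`
    have hdeg : L + 1 + 2 ≤ (n + 1) * (s + 1) := by
      rw [hLdef, Lnum]
      have : (2 * r + 1) * D * n + 3 ≤ (n + 1) * ((2 * r + 1) * D + 2) := by nlinarith
      calc (2 * r + 1) * D * n + 1 + 2 = (2 * r + 1) * D * n + 3 := by ring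
        _ ≤ (n + 1) * ((2 * r + 1) * D + 2) := this
        _ ≤ (n + 1) * (s + 1) := Nat.mul_le_mul_left _ hs
    have ht2 : ((2 * r + 2) * t) ^ (L + 1) * t ^ 2 ≤ (2 * r + 2) ^ (L + 1) * t ^ ((n + 1) * (s + 1)) := by
      rw [mul_pow, mul_assoc, ← pow_add]
      refine mul_le_mul_of_nonneg_left ?_ (by positivity)
      exact pow_le_pow_right₀ ht1 hdeg
    calc (D : ℝ) ^ L * (n ! : ℝ) ^ (s + 1 - (2 * r + 1) * D) *
          (∏ l ∈ range (L + 1), (t - r * n + (l : ℝ) / D)) * t ^ 2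
        ≤ (D : ℝ) ^ L * (n ! : ℝ) ^ (s + 1 - (2 * r + 1) * D) *
          (((2 * r + 2) * t) ^ (L + 1)) * t ^ 2 := by gcongr
      _ = (D : ℝ) ^ L * (n ! : ℝ) ^ (s + 1 - (2 * r + 1) * D) *
          ((((2 * r + 2) * t) ^ (L + 1)) * t ^ 2) := by ring
      _ ≤ (D : ℝ) ^ L * (n ! : ℝ) ^ (s + 1 - (2 * r + 1) * D) *
          ((2 * r + 2) ^ (L + 1) * t ^ ((n + 1) * (s + 1))) :=
          mul_le_mul_of_nonneg_left ht2 hC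
      _ ≤ (D : ℝ) ^ L * (n ! : ℝ) ^ (s + 1 - (2 * r + 1) * D) * (2 * r + 2) ^ (L + 1) *
          ∏ k ∈ range (n + 1), (t + k) ^ (s + 1) := by
          rw [← mul_assoc]
          exact mul_le_mul_of_nonneg_left hden_ge (by positivity)

/-- Summability of `m ↦ R_n(m + 1 + α)` for `0 ≤ α`. [folklore] -/
theorem summable_Rfun {r D s n : ℕ} (hn : 1 ≤ n) (hD : 0 < D) (hs : (2 * r + 1) * D + 2 ≤ s + 1)
    {α : ℝ} (hα : 0 ≤ α) : Summable (fun m : ℕ => Rfun r D s n ((m : ℝ) + 1 + α)) := by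
  have hg : Summable (fun m : ℕ => Kdec r D s n / ((m : ℝ) + 1) ^ 2) := by
    have := (summable_nat_add_iff 1).2 (Real.summable_one_div_nat_pow.2 one_lt_two)
    have h2 : Summable (fun m : ℕ => Kdec r D s n * (1 / ((m + 1 : ℕ) : ℝ) ^ 2)) := this.mul_left _
    refine h2.congr fun m => ?_
    push_cast; ring
  refine hg.of_norm_bounded_eventually_nat ?_
  filter_upwards [eventually_ge_atTop ((r + 1) * n)] with m hm
  have hm' : ((r : ℝ) + 1) * n ≤ (m : ℝ) + 1 + α := by
    have : (((r + 1) * n : ℕ) : ℝ) ≤ m := by exact_mod_cast hm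
    push_cast at this; linarith
  have h1 : (1 : ℝ) ≤ (m : ℝ) + 1 + α := by linarith [(m.cast_nonneg : (0 : ℝ) ≤ m)]
  obtain ⟨h0, hle⟩ := Rfun_bounds hn hD hs h1 hm'
  rw [Real.norm_eq_abs, abs_of_nonneg h0]
  refine hle.trans (div_le_div_of_nonneg_left (Kdec_nonneg r D s n) (by positivity) ?_)
  exact pow_le_pow_left₀ (by positivity) (by linarith) 2

/-- `t · R_n(t) → 0` as `t → +∞`. [folklore] -/
theorem tendsto_mul_Rfun {r D s n : ℕ} (hn : 1 ≤ n) (hD : 0 < D) (hs : (2 * r + 1) * D + 2 ≤ s + 1) :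
    Tendsto (fun t : ℝ => t * Rfun r D s n t) atTop (𝓝 0) := by
  have hK : Tendsto (fun t : ℝ => Kdec r D s n / t) atTop (𝓝 0) :=
    tendsto_const_nhds.div_atTop tendsto_id
  refine squeeze_zero' ?_ ?_ hK
  · filter_upwards [eventually_ge_atTop (1 : ℝ), eventually_ge_atTop (((r : ℝ) + 1) * n)] with t h1 h2
    exact mul_nonneg (by linarith) (Rfun_bounds hn hD hs h1 h2).1
  · filter_upwards [eventually_ge_atTop (1 : ℝ), eventually_ge_atTop (((r : ℝ) + 1) * n)] with t h1 h2
    have := (Rfun_bounds hn hD hs h1 h2).2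
    have ht : 0 < t := by linarith
    calc t * Rfun r D s n t ≤ t * (Kdec r D s n / t ^ 2) := mul_le_mul_of_nonneg_left this ht.le
      _ = Kdec r D s n / t := by field_simp

/-! ### The residues sum to zero -/

/-- `t/(t+k)^i → [i = 1]` as `t → +∞` (`k ≥ 0`, `i ≥ 1`). [folklore] -/
theorem tendsto_div_add_pow (k : ℕ) {i : ℕ} (hi : 1 ≤ i) :
    Tendsto (fun t : ℝ => t / (t + k) ^ i) atTop (𝓝 (if i = 1 then 1 else 0)) := by
  rcases eq_or_lt_of_le hi with h | h
  · subst h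
    simp only [if_true, pow_one]
    have h1 : Tendsto (fun t : ℝ => 1 - k / (t + k)) atTop (𝓝 (1 - 0)) :=
      tendsto_const_nhds.sub (tendsto_const_nhds.div_atTop
        (tendsto_atTop_add_const_right _ _ tendsto_id))
    rw [sub_zero] at h1
    refine h1.congr' ?_
    filter_upwards [eventually_gt_atTop (0 : ℝ)] with t ht
    have : t + k ≠ 0 := by positivity
    field_simp
    ring
  · rw [if_neg (by omega)]
    have h0 : Tendsto (fun t : ℝ => 1 / t) atTop (𝓝 0) := tendsto_const_nhds.div_atTop tendsto_id
    refine squeeze_zero' ?_ ?_ h0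
    · filter_upwards [eventually_gt_atTop (0 : ℝ)] with t ht
      positivity
    · filter_upwards [eventually_ge_atTop (1 : ℝ)] with t ht
      have hk : (0 : ℝ) ≤ k := Nat.cast_nonneg k
      have h2 : t ^ 2 ≤ (t + k) ^ i :=
        (pow_le_pow_right₀ ht (by omega)).trans (pow_le_pow_left₀ (by linarith) (by linarith) i)
      rw [div_le_div_iff₀ (by positivity) (by positivity)]
      nlinarith

/-- **The residues sum to zero** (FSZ 2019, proof of Lemma 1: `∑_k a_{1,k} = lim t R_n(t) = 0`):
for any expansion `R_n(t) = ∑_{k,i} c_{k,i}(t+k)^{-i}` valid for large `t`, `∑_k c_{k,1} = 0`.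
[cite: FischlerSprangZudilin2019, Lemma 1 (proof)] -/
theorem sum_coeff_one_eq_zero {r D s n p : ℕ} (hn : 1 ≤ n) (hD : 0 < D)
    (hs : (2 * r + 1) * D + 2 ≤ s + 1) (hp : 1 ≤ p) {c : ℕ → ℕ → ℝ} {T : ℝ}
    (hc : ∀ t : ℝ, T < t → Rfun r D s n t = pfEval n p c t) :
    ∑ k ∈ range (n + 1), c k 1 = 0 := by
  have hlim1 : Tendsto (fun t : ℝ => t * pfEval n p c t) atTop
      (𝓝 (∑ k ∈ range (n + 1), ∑ i ∈ Icc 1 p, c k i * (if i = 1 then 1 else 0))) := by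
    have : (fun t : ℝ => t * pfEval n p c t) =
        fun t => ∑ k ∈ range (n + 1), ∑ i ∈ Icc 1 p, c k i * (t / (t + k) ^ i) := by
      funext t
      rw [pfEval, mul_sum]
      refine sum_congr rfl fun k _ => ?_
      rw [mul_sum]
      refine sum_congr rfl fun i _ => ?_
      ring
    rw [this]
    refine tendsto_finsetSum _ fun k _ => tendsto_finsetSum _ fun i hi => ?_
    exact tendsto_const_nhds.mul (tendsto_div_add_pow k (mem_Icc.1 hi).1)
  have hsimp : ∑ k ∈ range (n + 1), ∑ i ∈ Icc 1 p, c k i * (if i = 1 then (1 : ℝ) else 0) =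
      ∑ k ∈ range (n + 1), c k 1 := by
    refine sum_congr rfl fun k _ => ?_
    rw [sum_eq_single_of_mem 1 (mem_Icc.2 ⟨le_rfl, hp⟩)]
    · simp
    · intro i _ hi; simp [hi]
  rw [hsimp] at hlim1
  have hlim2 : Tendsto (fun t : ℝ => t * pfEval n p c t) atTop (𝓝 0) := by
    refine (tendsto_mul_Rfun hn hD hs).congr' ?_
    filter_upwards [eventually_gt_atTop T] with t ht
    rw [hc t ht]
  exact tendsto_nhds_unique hlim1 hlim2

/-! ### Averaging with the mirror image -/

/-- Reflection of a sum over `range (n+1)`. [folklore] -/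
theorem sum_range_reflect' (f : ℕ → ℝ) (n : ℕ) :
    ∑ k ∈ range (n + 1), f (n - k) = ∑ k ∈ range (n + 1), f k := by
  have := sum_range_reflect f (n + 1)
  simpa using this

/-- **Symmetrised expansion.** If `L` is even and `s` odd, `R_n` has, for `t > 0`, an
expansion `∑_{k,i} b_{k,i}(t+k)^{-i}` with `2 d_n^{s+1-i} b_{k,i} ∈ ℤ` and
`∑_k b_{k,i} = 0` for every even `i` — obtained by averaging an integral expansion with its
image under `t ↦ -n-t` (Ball–Rivoal 2001, Lemme 1: only odd zeta values survive).
[cite: FischlerSprangZudilin2019, Lemma 1 (proof, a_{i,n-k} = (-1)^{i+1} a_{i,k})] -/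
theorem exists_symm_exp {r D s n : ℕ} (hn : 1 ≤ n) (hD : 0 < D) (hL : Even (Lnum r D n))
    (hs : Odd s) (hs' : (2 * r + 1) * D ≤ s) :
    ∃ b : ℕ → ℕ → ℝ, (∀ k i, IsZ (2 * dn n ^ (s + 1 - i) * b k i)) ∧
      (∀ i, Even i → ∑ k ∈ range (n + 1), b k i = 0) ∧
      ∀ t : ℝ, 0 < t → Rfun r D s n t = pfEval n (s + 1) b t := by
  obtain ⟨c, hc, hrep⟩ := isExp_Rfun hn hD hs'
  refine ⟨fun k i => (c k i + (-1) ^ (i + 1) * c (n - k) i) / 2, fun k i => ?_, fun i hi => ?_,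
    fun t ht => ?_⟩
  · have : 2 * dn n ^ (s + 1 - i) * ((c k i + (-1) ^ (i + 1) * c (n - k) i) / 2) =
        dn n ^ (s + 1 - i) * c k i + (-1) ^ (i + 1) * (dn n ^ (s + 1 - i) * c (n - k) i) := by
      ring
    rw [this]
    exact (hc k i).add ((IsZ.neg_one_pow _).mul (hc (n - k) i))
  · have h1 : (-1 : ℝ) ^ (i + 1) = -1 := Odd.neg_one_pow (hi.add_one)
    simp only [h1, neg_one_mul, ← sub_eq_add_neg, ← sum_div, sum_sub_distrib]
    rw [sum_range_reflect' (fun k => c k i) n, sub_self, zero_div]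
  · -- `R(t) = (pf c t + pf c' t)/2`
    have hA : Rfun r D s n t = pfEval n (s + 1) c t := hrep t (good_of_pos ht)
    have hB : Rfun r D s n t = -pfEval n (s + 1) c (-n - t) := by
      have h1 := Rfun_neg (r := r) (s := s) hD hL hs t
      have h2 : Good n (-(n : ℝ) - t) := good_of_lt_neg (by linarith)
      rw [hrep _ h2] at h1
      linarith
    have hB' : -pfEval n (s + 1) c (-n - t) =
        ∑ k ∈ range (n + 1), ∑ i ∈ Icc 1 (s + 1), (-1) ^ (i + 1) * c (n - k) i / (t + k) ^ i := by
      rw [pfEval, ← sum_range_reflect' (fun k => ∑ i ∈ Icc 1 (s + 1), c k i / (-(n : ℝ) - t + k) ^ i) n]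
      rw [← sum_neg_distrib]
      refine sum_congr rfl fun k hk => ?_
      have hkn : k ≤ n := by simpa [Nat.lt_succ_iff] using hk
      rw [← sum_neg_distrib]
      refine sum_congr rfl fun i _ => ?_
      rw [Nat.cast_sub hkn]
      have : (-(n : ℝ) - t + (n - k)) = -(t + k) := by ring
      have hinv : ((-1 : ℝ) ^ i)⁻¹ = (-1) ^ i := by rw [← inv_pow, inv_neg, inv_one]
      rw [this, neg_pow, pow_succ, mul_comm ((-1 : ℝ) ^ i) _, ← div_div,
        div_eq_mul_inv _ ((-1 : ℝ) ^ i), hinv]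
      ring
    have : Rfun r D s n t = (pfEval n (s + 1) c t + -pfEval n (s + 1) c (-n - t)) / 2 := by
      linarith
    rw [this, hB', pfEval, pfEval, ← sum_add_distrib, sum_div]
    refine sum_congr rfl fun k _ => ?_
    rw [← sum_add_distrib, sum_div]
    refine sum_congr rfl fun i _ => ?_
    ring

/-! ### Hurwitz-type sums -/

/-- Partial sums `∑_{ν<M} (ν+α)^{-i}`. [folklore] -/
def hzp (i : ℕ) (α : ℝ) (M : ℕ) : ℝ := ∑ ν ∈ range M, 1 / ((ν : ℝ) + α) ^ i

/-- The Hurwitz zeta value `ζ(i, α) = ∑_{ν ≥ 0} (ν+α)^{-i}` for an integer `i ≥ 2` and real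
`α > 0` (as a real series; Mathlib's `HurwitzZeta` is not needed here).
[cite: FischlerSprangZudilin2019, §2 (definition of ζ(i,α))] -/
def hz (i : ℕ) (α : ℝ) : ℝ := ∑' ν : ℕ, 1 / ((ν : ℝ) + α) ^ i

/-- Summability of the Hurwitz series for `i ≥ 2`, `α > 0`. [folklore] -/
theorem summable_hz {i : ℕ} (hi : 2 ≤ i) {α : ℝ} (hα : 0 < α) :
    Summable (fun ν : ℕ => 1 / ((ν : ℝ) + α) ^ i) := by
  rw [← summable_nat_add_iff 1]
  have hg : Summable (fun ν : ℕ => 1 / ((ν + 1 : ℕ) : ℝ) ^ 2) :=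
    (summable_nat_add_iff 1).2 (Real.summable_one_div_nat_pow.2 one_lt_two)
  refine hg.of_nonneg_of_le (fun ν => by positivity) fun ν => ?_
  have h1 : (1 : ℝ) ≤ ((ν + 1 : ℕ) : ℝ) + α := by push_cast; linarith [(Nat.cast_nonneg (α := ℝ) ν)]
  have h2 : ((ν + 1 : ℕ) : ℝ) ^ 2 ≤ (((ν + 1 : ℕ) : ℝ) + α) ^ i :=
    (pow_le_pow_left₀ (by positivity) (by linarith) 2).trans (pow_le_pow_right₀ h1 hi)
  exact one_div_le_one_div_of_le (by positivity) h2

/-- `hzp i α M → hz i α`. [folklore] -/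
theorem tendsto_hzp {i : ℕ} (hi : 2 ≤ i) {α : ℝ} (hα : 0 < α) (k : ℕ) :
    Tendsto (fun N : ℕ => hzp i α (N + k)) atTop (𝓝 (hz i α)) :=
  ((summable_hz hi hα).hasSum.tendsto_sum_nat).comp (tendsto_add_atTop_nat k)

/-- `0 ≤ hzp 1 α (N+k) - hzp 1 α N ≤ k/N`: the tails of the harmonic-type sums. [folklore] -/
theorem hzp_one_sub_le {α : ℝ} (hα : 0 < α) (N k : ℕ) (hN : 1 ≤ N) :
    0 ≤ hzp 1 α (N + k) - hzp 1 α N ∧ hzp 1 α (N + k) - hzp 1 α N ≤ k / N := by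
  have he : hzp 1 α (N + k) - hzp 1 α N = ∑ m ∈ range k, 1 / (((N + m : ℕ) : ℝ) + α) ^ 1 := by
    rw [hzp, hzp, sum_range_add]; ring
  rw [he]
  refine ⟨sum_nonneg fun m _ => by positivity, ?_⟩
  have hN' : (0 : ℝ) < N := by exact_mod_cast hN
  calc ∑ m ∈ range k, 1 / (((N + m : ℕ) : ℝ) + α) ^ 1 ≤ ∑ _m ∈ range k, (1 / (N : ℝ)) := by
        refine sum_le_sum fun m _ => ?_
        rw [pow_one]
        exact one_div_le_one_div_of_le hN' (by push_cast; linarith [(Nat.cast_nonneg (α := ℝ) m)])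
    _ = k / N := by rw [sum_const, card_range]; simp [div_eq_mul_inv]

/-- Splitting off the `i = 1` term of a sum over `Icc 1 p`. [folklore] -/
theorem sum_Icc_one_eq {p : ℕ} (hp : 1 ≤ p) (g : ℕ → ℝ) :
    ∑ i ∈ Icc 1 p, g i = g 1 + ∑ i ∈ Icc 2 p, g i := by
  rw [← Finset.insert_Icc_succ_left_eq_Icc hp, sum_insert (by simp)]
  rfl

/-- **Series evaluation** (Zudilin 2018, Lemma 3; Sprang 2018, Lemma 1.5; FSZ 2019, Lemma 1):
if `R_n(t) = ∑_{k,i} b_{k,i}(t+k)^{-i}` for `t > 0` with `∑_k b_{k,1} = 0`, then for `α > 0`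
`∑_{m ≥ 0} R_n(m+1+α) = ∑_{k} ∑_{i ≥ 2} b_{k,i} ζ(i,α) - ∑_k ∑_{i ≥ 1} b_{k,i} ∑_{ν ≤ k} (ν+α)^{-i}`.
[cite: FischlerSprangZudilin2019, Lemma 1] -/
theorem hasSum_Rfun_shift {r D s n p : ℕ} (hn : 1 ≤ n) (hD : 0 < D)
    (hs : (2 * r + 1) * D + 2 ≤ s + 1) (hp : 1 ≤ p) {b : ℕ → ℕ → ℝ}
    (hb : ∀ t : ℝ, 0 < t → Rfun r D s n t = pfEval n p b t)
    (hb1 : ∑ k ∈ range (n + 1), b k 1 = 0) {α : ℝ} (hα : 0 < α) :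
    HasSum (fun m : ℕ => Rfun r D s n ((m : ℝ) + 1 + α))
      (∑ k ∈ range (n + 1), ∑ i ∈ Icc 2 p, b k i * hz i α -
        ∑ k ∈ range (n + 1), ∑ i ∈ Icc 1 p, b k i * hzp i α (k + 1)) := by
  set f : ℕ → ℝ := fun m => Rfun r D s n ((m : ℝ) + 1 + α) with hf
  have hsum : Summable f := summable_Rfun hn hD hs hα.le
  -- partial sums
  have hpartial : ∀ N : ℕ, ∑ m ∈ range N, f m =
      ∑ k ∈ range (n + 1), ∑ i ∈ Icc 1 p, b k i * hzp i α (N + (k + 1)) -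
        ∑ k ∈ range (n + 1), ∑ i ∈ Icc 1 p, b k i * hzp i α (k + 1) := by
    intro N
    have htail : ∀ k i, hzp i α (N + (k + 1)) - hzp i α (k + 1) =
        ∑ m ∈ range N, 1 / (((k + 1 + m : ℕ) : ℝ) + α) ^ i := by
      intro k i
      rw [hzp, hzp, add_comm N, sum_range_add]; ring
    have hR : ∑ k ∈ range (n + 1), ∑ i ∈ Icc 1 p, b k i * hzp i α (N + (k + 1)) -
        ∑ k ∈ range (n + 1), ∑ i ∈ Icc 1 p, b k i * hzp i α (k + 1) =
        ∑ m ∈ range N, ∑ k ∈ range (n + 1), ∑ i ∈ Icc 1 p,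
          b k i * (1 / (((k + 1 + m : ℕ) : ℝ) + α) ^ i) := by
      rw [← sum_sub_distrib]
      simp_rw [← sum_sub_distrib, ← mul_sub, htail, mul_sum]
      rw [show (∑ k ∈ range (n + 1), ∑ i ∈ Icc 1 p, ∑ m ∈ range N,
          b k i * (1 / (((k + 1 + m : ℕ) : ℝ) + α) ^ i)) =
          ∑ k ∈ range (n + 1), ∑ m ∈ range N, ∑ i ∈ Icc 1 p,
            b k i * (1 / (((k + 1 + m : ℕ) : ℝ) + α) ^ i) from
        sum_congr rfl fun k _ => sum_comm]
      rw [sum_comm]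
    have hL : ∑ m ∈ range N, f m = ∑ m ∈ range N, ∑ k ∈ range (n + 1), ∑ i ∈ Icc 1 p,
          b k i * (1 / (((k + 1 + m : ℕ) : ℝ) + α) ^ i) := by
      refine sum_congr rfl fun m _ => ?_
      rw [hf]
      simp only
      rw [hb _ (by positivity), pfEval]
      refine sum_congr rfl fun k _ => sum_congr rfl fun i _ => ?_
      push_cast
      rw [show (m : ℝ) + 1 + α + k = (k : ℝ) + 1 + m + α by ring]
      ring
    rw [hL, hR]
  -- the limit of the first block
  have hlimA : Tendsto (fun N : ℕ => ∑ k ∈ range (n + 1), ∑ i ∈ Icc 1 p, b k i * hzp i α (N + (k + 1)))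
      atTop (𝓝 (∑ k ∈ range (n + 1), ∑ i ∈ Icc 2 p, b k i * hz i α)) := by
    -- split `i = 1`
    have hsplit : ∀ N : ℕ, ∑ k ∈ range (n + 1), ∑ i ∈ Icc 1 p, b k i * hzp i α (N + (k + 1)) =
        ∑ k ∈ range (n + 1), b k 1 * (hzp 1 α (N + (k + 1)) - hzp 1 α N) +
          ∑ k ∈ range (n + 1), ∑ i ∈ Icc 2 p, b k i * hzp i α (N + (k + 1)) := by
      intro N
      rw [← sum_add_distrib]
      have hcorr : ∑ k ∈ range (n + 1), b k 1 * hzp 1 α N = 0 := by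
        rw [← sum_mul, hb1, zero_mul]
      have : ∀ k, b k 1 * (hzp 1 α (N + (k + 1)) - hzp 1 α N) =
          b k 1 * hzp 1 α (N + (k + 1)) - b k 1 * hzp 1 α N := fun k => by ring
      simp_rw [this]
      rw [show (∑ k ∈ range (n + 1), (b k 1 * hzp 1 α (N + (k + 1)) - b k 1 * hzp 1 α N +
          ∑ i ∈ Icc 2 p, b k i * hzp i α (N + (k + 1)))) =
          ∑ k ∈ range (n + 1), (b k 1 * hzp 1 α (N + (k + 1)) +
            ∑ i ∈ Icc 2 p, b k i * hzp i α (N + (k + 1))) - ∑ k ∈ range (n + 1), b k 1 * hzp 1 α N by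
        rw [← sum_sub_distrib]; refine sum_congr rfl fun k _ => ?_; ring]
      rw [hcorr, sub_zero]
      refine sum_congr rfl fun k _ => ?_
      rw [sum_Icc_one_eq hp]
    simp_rw [hsplit]
    rw [show (∑ k ∈ range (n + 1), ∑ i ∈ Icc 2 p, b k i * hz i α) =
        ∑ k ∈ range (n + 1), b k 1 * 0 + ∑ k ∈ range (n + 1), ∑ i ∈ Icc 2 p, b k i * hz i α by simp]
    refine Tendsto.add ?_ ?_
    · refine tendsto_finsetSum _ fun k _ => tendsto_const_nhds.mul ?_
      have h0 : Tendsto (fun N : ℕ => ((k + 1 : ℕ) : ℝ) / N) atTop (𝓝 0) :=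
        tendsto_const_div_atTop_nhds_zero_nat _
      refine squeeze_zero' ?_ ?_ h0
      · filter_upwards [eventually_ge_atTop 1] with N hN
        exact (hzp_one_sub_le hα N (k + 1) hN).1
      · filter_upwards [eventually_ge_atTop 1] with N hN
        exact (hzp_one_sub_le hα N (k + 1) hN).2
    · refine tendsto_finsetSum _ fun k _ => tendsto_finsetSum _ fun i hi => ?_
      exact tendsto_const_nhds.mul (tendsto_hzp (mem_Icc.1 hi).1 hα (k + 1))
  have hlim : Tendsto (fun N : ℕ => ∑ m ∈ range N, f m) atTop
      (𝓝 (∑ k ∈ range (n + 1), ∑ i ∈ Icc 2 p, b k i * hz i α -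
        ∑ k ∈ range (n + 1), ∑ i ∈ Icc 1 p, b k i * hzp i α (k + 1))) := by
    simp_rw [hpartial]
    exact hlimA.sub tendsto_const_nhds
  have hV := tendsto_nhds_unique hsum.hasSum.tendsto_sum_nat hlim
  rw [← hV]
  exact hsum.hasSum

/-! ### The linear forms -/

/-- `d_n ∣ d_N` for `n ≤ N`, as reals: `d_N / d_n ∈ ℤ`. [folklore] -/
theorem isZ_dn_div_dn {n N : ℕ} (h : n ≤ N) : IsZ (dn N / dn n) := by
  have hd : (Nat.lcmUpto n : ℤ) ∣ (Nat.lcmUpto N : ℤ) := by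
    exact_mod_cast Literature.NumberTheory.LFunctions.lcmUpto_dvd_lcmUpto_of_le h
  have := IsZ.of_dvd (by exact_mod_cast (Nat.lcmUpto_pos n).ne') hd
  simpa [dn] using this

/-- For `1 ≤ q ≤ N`, `d_N / q ∈ ℤ`. [folklore] -/
theorem isZ_dn_div_nat {q N : ℕ} (h1 : 1 ≤ q) (h2 : q ≤ N) : IsZ (dn N / q) := by
  have hd : (q : ℤ) ∣ (Nat.lcmUpto N : ℤ) := by exact_mod_cast dvd_lcmUpto h1 h2
  have := IsZ.of_dvd (by exact_mod_cast (show q ≠ 0 by omega)) hd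
  simpa [dn] using this

/-- **The linear forms in Hurwitz zeta values** (Sprang 2018, Lemma 1.5; Fischler–Sprang–Zudilin
2019, Lemmas 1 and 2; the Ball–Rivoal mechanism with Sprang's twist `j/D`). Let `n ≥ 1`,
`L = (2r+1)Dn` even, `s` odd, `(2r+1)D + 1 ≤ s`. There are reals `ρ_i` (`i ≤ s+1`,
independent of `j`) and `ρ_{0,j}` such that for every `1 ≤ j ≤ D`

`∑_{m ≥ 1} R_n(m + j/D) = ρ_{0,j} + ∑_{2 ≤ i ≤ s+1} ρ_i ζ(i, j/D)`,

with `ρ_i = 0` for even `i`, `2 d_n^{s+1-i} ρ_i ∈ ℤ` and `2 d_{D(n+1)}^{s+1} ρ_{0,j} ∈ ℤ`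
(FSZ prove the sharper `d_{n+1}^{s+1} ρ_{0,j} ∈ ℤ` by a `p`-adic argument; the crude
denominator suffices here, and the factor `2` comes from symmetrising the expansion).
[cite: FischlerSprangZudilin2019, Lemma 1 and Lemma 2] -/
theorem linear_forms {r D s n : ℕ} (hn : 1 ≤ n) (hD : 0 < D) (hL : Even (Lnum r D n))
    (hs : Odd s) (hs' : (2 * r + 1) * D + 2 ≤ s + 1) :
    ∃ (ρ : ℕ → ℝ) (ρ0 : ℕ → ℝ),
      (∀ i, Even i → ρ i = 0) ∧
      (∀ i, IsZ (2 * dn n ^ (s + 1 - i) * ρ i)) ∧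
      (∀ j, 1 ≤ j → j ≤ D → IsZ (2 * dn (D * (n + 1)) ^ (s + 1) * ρ0 j)) ∧
      ∀ j, 1 ≤ j → j ≤ D →
        HasSum (fun m : ℕ => Rfun r D s n ((m : ℝ) + 1 + (j : ℝ) / D))
          (ρ0 j + ∑ i ∈ Icc 2 (s + 1), ρ i * hz i ((j : ℝ) / D)) := by
  obtain ⟨b, hbZ, hbeven, hbrep⟩ := exists_symm_exp hn hD hL hs (by omega)
  have hb1 : ∑ k ∈ range (n + 1), b k 1 = 0 :=
    sum_coeff_one_eq_zero hn hD hs' (p := s + 1) (by omega) (T := 0) fun t ht => hbrep t ht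
  have hD' : (0 : ℝ) < D := by exact_mod_cast hD
  refine ⟨fun i => ∑ k ∈ range (n + 1), b k i,
    fun j => -∑ k ∈ range (n + 1), ∑ i ∈ Icc 1 (s + 1), b k i * hzp i ((j : ℝ) / D) (k + 1),
    fun i hi => hbeven i hi, fun i => ?_, fun j hj1 hjD => ?_, fun j hj1 hjD => ?_⟩
  · rw [mul_sum]
    exact IsZ.sum _ fun k _ => hbZ k i
  · rw [mul_neg, mul_sum]
    refine IsZ.neg (IsZ.sum _ fun k hk => ?_)
    have hkn : k ≤ n := by simpa [Nat.lt_succ_iff] using hk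
    rw [mul_sum]
    refine IsZ.sum _ fun i hi => ?_
    obtain ⟨hi1, hi2⟩ := mem_Icc.1 hi
    rw [hzp, mul_sum, mul_sum]
    refine IsZ.sum _ fun ν hν => ?_
    have hνk : ν ≤ k := Nat.lt_succ_iff.1 (mem_range.1 hν)
    set N := D * (n + 1) with hN
    have hq1 : 1 ≤ D * ν + j := by omega
    have hq2 : D * ν + j ≤ N := by rw [hN]; nlinarith
    have hq : ((D * ν + j : ℕ) : ℝ) ≠ 0 := by exact_mod_cast (show D * ν + j ≠ 0 by omega)
    have hdn : dn n ≠ 0 := (dn_pos n).ne'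
    have hnN : n ≤ N := by rw [hN]; nlinarith
    -- the identity
    have key : 2 * dn N ^ (s + 1) * (b k i * (1 / ((ν : ℝ) + (j : ℝ) / D) ^ i)) =
        (2 * dn n ^ (s + 1 - i) * b k i) * (dn N / dn n) ^ (s + 1 - i) *
          ((D : ℝ) * (dn N / ((D * ν + j : ℕ) : ℝ))) ^ i := by
      have e1 : (ν : ℝ) + (j : ℝ) / D = ((D * ν + j : ℕ) : ℝ) / D := by
        push_cast; field_simp
      rw [e1, show dn N ^ (s + 1) = dn N ^ (s + 1 - i) * dn N ^ i by rw [← pow_add]; congr 1; omega]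
      have hD0 : (D : ℝ) ≠ 0 := hD'.ne'
      have hdN : dn N ≠ 0 := (dn_pos N).ne'
      rw [div_pow, div_pow, mul_pow, div_pow]
      field_simp
    rw [key]
    exact ((hbZ k i).mul ((isZ_dn_div_dn hnN).pow _)).mul
      (((IsZ.nat D).mul (isZ_dn_div_nat hq1 hq2)).pow _)
  · have hα : (0 : ℝ) < (j : ℝ) / D := by
      have : (1 : ℝ) ≤ j := by exact_mod_cast hj1
      positivity
    have h := hasSum_Rfun_shift hn hD hs' (p := s + 1) (by omega) hbrep hb1 hα
    convert h using 1
    rw [sub_eq_neg_add]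
    congr 1
    rw [sum_comm]
    refine sum_congr rfl fun i _ => ?_
    rw [sum_mul]

end Literature.NumberTheory.Transcendental.OddZeta
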